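import Literature.Topology.FourManifolds.BordismFourFiniteness
import Literature.AlgebraicTopology.SingularHomology.LefschetzDualityProofs
import Literature.AlgebraicTopology.SingularHomology.PoincareDualityProofs
import HarnessLib

/-!
# Thom's Thm IV.1 in dimension four, proved: discharge of `signature_eq_of_isOrientedBordant`

Sibling proof file of `Literature.Topology.FourManifolds.BordismFourProofs` (where the named fact
`Literature.Topology.FourManifolds.signature_eq_of_isOrientedBordant` is stated) and of
`Literature.Topology.FourManifolds.BordismFourFiniteness` (where it is proved from Lefschetz
duality and Poincaré duality alone, `signature_eq_of_isOrientedBordant_of_duality''`; see also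
`signature_eq_of_isOrientedBordant_of_lefschetz` in `…BordismFourDuality`).

R. Thom, *Quelques propriétés globales des variétés différentiables*, Comment. Math. Helv. 28
(1954), Ch. IV §2, **Thm IV.1** (p. 65): "Si deux variétés `V`, `V'`, orientées, de dimension
`4k`, sont cobordantes, les formes quadratiques définies par le cup-produit sur `H^{2k}(V)` resp.
`H^{2k}(V')` ont même index `τ`."  Printed proof (loc. cit.): Thm V.11 of Thom (1952) — the index
of an oriented "variété-bord" vanishes, itself Thm V.7/Cor. V.8 (Poincaré–Lefschetz duality for
the compact manifold it bounds: `r_p + r_{n−p} = b_p`, Ann. Sci. ENS 69, p. 173) and the algebra of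
p. 176 ("l'indice d'inertie est égal à `Inf(p, b − p)`") — plus additivity of `τ`.

The tree follows exactly this architecture for `k = 1` (see the module docstrings of
`BordismFourProofs`, `…Normalization`, `…Orientation`, `…Signature`, `…BoundaryClass`,
`…Finiteness`, `…Duality`): isotropy of `A² = i^* H²(W) ⊂ H²(∂W)` (Thm V.7, easy half), the rank
identity `2 r₂ = b₂(M) + b₂(N)` (Cor. V.8) from the duality ladder "half lives, half dies", and
Thom's `Inf(p, b − p)` argument, applied to the whole boundary `∂W = M ⊔ N̄` of a cobordism.  The
last standing input, Lefschetz duality for compact 5-manifolds with boundary (Spanier Thm. 6.3.12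
= Hatcher Thm. 3.43), is now the theorem
`Literature.AlgebraicTopology.SingularHomology.bijective_relCapProduct_of_isRelFundamentalClass_holds`
(`…LefschetzDualityProofs`, every universe); Poincaré duality of the closed ends (Hatcher
Thm. 3.30) is `Literature.AlgebraicTopology.SingularHomology.poincare_duality`
(`…PoincareDualityProofs`).  Hence:

* `signature_eq_of_isOrientedBordant_holds` — **Thm IV.1 for `k = 1`, unconditionally**: oriented
  bordant closed smooth `ℤ`-oriented 4-manifolds have equal signature.

No definitions, no named facts.

## References

* R. Thom, *Quelques propriétés globales des variétés différentiables*, Comment. Math. Helv. 28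
  (1954) 17–86, Ch. IV §2, Thm IV.1 (p. 65). [ThomCMH1954]
* R. Thom, *Espaces fibrés en sphères et carrés de Steenrod*, Ann. Sci. ENS 69 (1952) 109–182,
  Thm V.7, Cor. V.8 (p. 173), Thm V.10, Cor. V.11 (p. 176). [Thom1952]
* E. H. Spanier, *Algebraic Topology*, Springer 1981, Ch. 6 §3 Thm. 12. [Spanier1981]
* A. Hatcher, *Algebraic Topology*, CUP 2002, §3.3 Thm. 3.30, Thm. 3.43. [HatcherAT2002]
-/

noncomputable section

open scoped Manifold

universe u

namespace Literature.Topology.FourManifolds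

/-- **Thom (1954), Thm IV.1 in dimension four — discharge of the named fact
`Literature.Topology.FourManifolds.signature_eq_of_isOrientedBordant`.**  For closed smooth
4-manifolds `M`, `N` with homological `ℤ`-orientations `μ`, `ν`: if `(M, μ)` and `(N, ν)` are
oriented bordant (`IsOrientedBordant 4 μ ν`: a compact smooth cobordism `W` and a class
`w ∈ H₅(W, ∂W; ℤ)` with `∂w = (inl)_*[M]_μ − (inr)_*[N]_ν`), then `σ(M, μ) = σ(N, ν)`
("ont même index `τ`").  Proof: `signature_eq_of_isOrientedBordant_of_duality''` (Thom's
architecture, Cor. V.8 + p. 176 of Thom 1952) fed with Lefschetz duality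
`bijective_relCapProduct_of_isRelFundamentalClass_holds` in bidegree `(2, 3)` for compact
5-manifolds with boundary and with Poincaré duality `poincare_duality` in bidegree `(2, 2)` for
the closed ends.  PROVED, every universe.
[cite: ThomCMH1954, Thm IV.1 (p. 65)] -/
theorem signature_eq_of_isOrientedBordant_holds : signature_eq_of_isOrientedBordant.{u} :=
  signature_eq_of_isOrientedBordant_of_duality''
    (fun {W} _ _ _ _ z hz =>
      Literature.AlgebraicTopology.SingularHomology.bijective_relCapProduct_of_isRelFundamentalClass_holds
        4 W z hz (show 2 + (2 + 1) = 4 + 1 by rfl))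
    (fun π => Literature.AlgebraicTopology.SingularHomology.poincare_duality π two_add_two_eq_four)

end Literature.Topology.FourManifolds

end
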